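/-
Origin: expansion seat `planner-pub-hodgecm-pv10-g5-0`, handover #6(3/6) 2026-08-18T15:21:38Z ; rewrite: ^import Pv10g5\.QuotientHolomorphic -> import HodgeCM.PerL34.QuotientHolomorphic (`HOME/pub-hodgecm-pv10-g5/lean/Pv10g5/QuotientFunctions.lean`, md5 632e0530, 144 lines);
landed by the gen-8 packager in gate run 31 as `HodgeCM/PerL34/QuotientFunctions.lean` (import ^import Pv10g5\.QuotientHolomorphic[ \t]*$→import HodgeCM.PerL34.QuotientHolomorphic ×1; stripped 2 #print/#check/#eval lines).
-/
/-
Origin: pub-hodgecm speedrun cell, seat pv10-g5 (DAG-NODE PROVER #10, gen 5), 2026-08-18.  STAGING for the tree import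
(LEAN-IN-TREE RULE 2026-08-18): tree-shaped (≤ 400 lines, docstring on every decl, general engine and ball/PerL
specialisation in separate files); see `HOME/pub-hodgecm-pv10-g5/MODULE-MAP-pv10.md`.
Target path: `HodgeCM/PerL34/QuotientFunctions.lean`.  Proposed tree home: the manifold-quotient ENGINE module
(Mathlib-level, ball-free).
WIP import `Pv10g5.QuotientHolomorphic` ↦ `HodgeCM.PerL34.QuotientHolomorphic` at landing (ONE rewrite).  KERNEL,
nothing cited, nothing posited.
-/
import Summits.HodgeConjecture.HodgeCM.PerL34.QuotientHolomorphic

/-!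
# Functions on `G\M` = `G`-invariant functions on `M` (descent of `C^n` regularity)

Descent (ns `HodgeCM.PerL34.QuotientManifold`, general free properly discontinuous `G ↷ M` by `C^n` maps,
quotient structure of `QuotientManifold.lean`): a function `f : G\M → N` into any charted space is `C^n`
(resp. differentiable) iff `f ∘ π` is (`contMDiff_comp_mk_iff`, `mdifferentiable_comp_mk_iff`); hence `C^n` maps
`G\M → N` are "the same as" `G`-invariant `C^n` maps `M → N` (`invariantEquiv`, `contMDiff_invariantEquiv_iff`).
The ball / PerL specialisation (classical holomorphy on the open ball, Liouville on compact `Γ\𝔹²`,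
`H⁰(P^L_{Γ,b}, 𝒪) = ℂ`) is the companion file `BallQuotientFunctions`.
`#print axioms` of every result = `[propext, Classical.choice, Quot.sound]`.
-/

noncomputable section

open scoped Matrix Pointwise Manifold ContDiff Topology
open MulAction Set

namespace HodgeCM.PerL34.QuotientManifold

section Invariant

variable (G : Type*) [Group G] (M : Type*) [MulAction G M] (N : Type*)

/-- `G`-invariant functions `M → N` ARE functions `G\M → N` (`Quotient.lift`; no regularity). -/
def invariantEquiv : {F : M → N // ∀ g : G, ∀ x : M, F (g • x) = F x} ≃ (orbitRel.Quotient G M → N) where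
  toFun F := Quotient.lift F.1 fun a b (h : a ∈ orbit G b) => by
    obtain ⟨g, rfl⟩ := h
    exact F.2 g b
  invFun f := ⟨f ∘ Quotient.mk (orbitRel G M), fun g x =>
    congrArg f (Quotient.sound (mem_orbit x g : g • x ∈ orbit G x))⟩
  left_inv F := by ext x; rfl
  right_inv f := by
    funext q
    obtain ⟨p, rfl⟩ := Quotient.mk_surjective (s := orbitRel G M) q
    rfl

variable {G M N} in
/-- The descended function of an invariant `F` takes the value `F p` on the orbit of `p`. -/
@[simp] theorem invariantEquiv_apply_mk (F : {F : M → N // ∀ g : G, ∀ x : M, F (g • x) = F x}) (p : M) :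
    invariantEquiv G M N F (Quotient.mk (orbitRel G M) p) = F.1 p := rfl

variable {G M N} in
/-- The descended function of an invariant `F`, composed with the quotient map, is `F`. -/
theorem invariantEquiv_comp_mk (F : {F : M → N // ∀ g : G, ∀ x : M, F (g • x) = F x}) :
    invariantEquiv G M N F ∘ Quotient.mk (orbitRel G M) = F.1 := rfl

end Invariant

variable {G : Type*} [Group G] {M : Type*} [TopologicalSpace M] [MulAction G M]
  [ProperlyDiscontinuousSMul G M] [ContinuousConstSMul G M] [IsCancelSMul G M] [T2Space M]
  [LocallyCompactSpace M] {H : Type*} [TopologicalSpace H] [ChartedSpace H M]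

section Descent

variable {𝕜 : Type*} [NontriviallyNormedField 𝕜] {E : Type*} [NormedAddCommGroup E] [NormedSpace 𝕜 E]
  {I : ModelWithCorners 𝕜 E H} {n : WithTop ℕ∞} [IsManifold I n M]
  {E' : Type*} [NormedAddCommGroup E'] [NormedSpace 𝕜 E'] {H' : Type*} [TopologicalSpace H']
  {J : ModelWithCorners 𝕜 E' H'} {N : Type*} [TopologicalSpace N] [ChartedSpace H' N]

/-- **Descent of regularity**: `f : G\M → N` is `C^n` at `π p` iff `f ∘ π` is `C^n` at `p`. -/
theorem contMDiffAt_comp_mk_iff (hG : ActsBy G M (contDiffGroupoid n I)) {f : orbitRel.Quotient G M → N}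
    (p : M) : ContMDiffAt I J n (f ∘ Quotient.mk (orbitRel G M)) p ↔
      ContMDiffAt I J n f (Quotient.mk (orbitRel G M) p) := by
  constructor
  · intro h
    have h1 : ContMDiffAt I I n (localSection G p) (Quotient.mk (orbitRel G M) p) :=
      contMDiffAt_localSection hG p (mem_localSection_source p)
    have h2 : ContMDiffAt I J n (f ∘ Quotient.mk (orbitRel G M))
        (localSection G p (Quotient.mk (orbitRel G M) p)) := by rwa [localSection_apply_mk]
    refine (h2.comp _ h1).congr_of_eventuallyEq ?_
    filter_upwards [(localSection G p).open_source.mem_nhds (mem_localSection_source p)] with q hq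
    simp only [Function.comp_apply, mk_localSection_apply p hq]
  · intro h
    exact h.comp p (contMDiff_mk hG p)

/-- **`f : G\M → N` is `C^n` iff `f ∘ π : M → N` is.** -/
theorem contMDiff_comp_mk_iff (hG : ActsBy G M (contDiffGroupoid n I)) {f : orbitRel.Quotient G M → N} :
    ContMDiff I J n (f ∘ Quotient.mk (orbitRel G M)) ↔ ContMDiff I J n f := by
  constructor
  · intro h q
    obtain ⟨p, rfl⟩ := Quotient.mk_surjective (s := orbitRel G M) q
    exact (contMDiffAt_comp_mk_iff hG p).mp (h p)
  · intro h p
    exact (contMDiffAt_comp_mk_iff hG p).mpr (h _)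

/-- Differentiable version: `f : G\M → N` is differentiable at `π p` iff `f ∘ π` is differentiable at `p`
(`n ≠ 0`). -/
theorem mdifferentiableAt_comp_mk_iff (hG : ActsBy G M (contDiffGroupoid n I)) (hn : n ≠ 0)
    {f : orbitRel.Quotient G M → N} (p : M) :
    MDifferentiableAt I J (f ∘ Quotient.mk (orbitRel G M)) p ↔
      MDifferentiableAt I J f (Quotient.mk (orbitRel G M) p) := by
  constructor
  · intro h
    have h1 : MDifferentiableAt I I (localSection G p) (Quotient.mk (orbitRel G M) p) :=
      (contMDiffAt_localSection hG p (mem_localSection_source p)).mdifferentiableAt hn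
    have h2 : MDifferentiableAt I J (f ∘ Quotient.mk (orbitRel G M))
        (localSection G p (Quotient.mk (orbitRel G M) p)) := by rwa [localSection_apply_mk]
    refine (h2.comp _ h1).congr_of_eventuallyEq ?_
    filter_upwards [(localSection G p).open_source.mem_nhds (mem_localSection_source p)] with q hq
    simp only [Function.comp_apply, mk_localSection_apply p hq]
  · intro h
    exact h.comp p ((contMDiff_mk hG p).mdifferentiableAt hn)

/-- **`f : G\M → N` is differentiable iff `f ∘ π` is** (`n ≠ 0`). -/
theorem mdifferentiable_comp_mk_iff (hG : ActsBy G M (contDiffGroupoid n I)) (hn : n ≠ 0)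
    {f : orbitRel.Quotient G M → N} :
    MDifferentiable I J (f ∘ Quotient.mk (orbitRel G M)) ↔ MDifferentiable I J f := by
  constructor
  · intro h q
    obtain ⟨p, rfl⟩ := Quotient.mk_surjective (s := orbitRel G M) q
    exact (mdifferentiableAt_comp_mk_iff hG hn p).mp (h p)
  · intro h p
    exact (mdifferentiableAt_comp_mk_iff hG hn p).mpr (h _)

/-- **`C^n` functions on `G\M` = `G`-invariant `C^n` functions on `M`**: under `invariantEquiv`, `F` is `C^n`
iff its descent is. -/
theorem contMDiff_invariantEquiv_iff (hG : ActsBy G M (contDiffGroupoid n I))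
    (F : {F : M → N // ∀ g : G, ∀ x : M, F (g • x) = F x}) :
    ContMDiff I J n (invariantEquiv G M N F) ↔ ContMDiff I J n F.1 := by
  rw [← contMDiff_comp_mk_iff hG, invariantEquiv_comp_mk]

/-- DESCENT for differentiability (`n ≠ 0`): the descended function of an invariant `F` is differentiable iff `F` is. -/
theorem mdifferentiable_invariantEquiv_iff (hG : ActsBy G M (contDiffGroupoid n I)) (hn : n ≠ 0)
    (F : {F : M → N // ∀ g : G, ∀ x : M, F (g • x) = F x}) :
    MDifferentiable I J (invariantEquiv G M N F) ↔ MDifferentiable I J F.1 := by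
  rw [← mdifferentiable_comp_mk_iff hG hn, invariantEquiv_comp_mk]

end Descent

end HodgeCM.PerL34.QuotientManifold

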